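import Summits.Ventures.Crystal3D.Theorems.StickyWulffConstantPolycrystalWulffBoundArrangementRefinementMulti

/-!
# `PolycrystalWulffBound`: the disjoint refinement with ANTISYMMETRIC common-plane normals

Route `StickyWulffConstant` of the venture `Summits/Ventures/Crystal3D`, crux `PolycrystalWulffBound`
(item `stmt-Ventures-19482`), second prover lane; post-processing of
`exists_disjoint_polytope_refinement_multi` (`…ArrangementRefinementMulti.lean`).  Clause (B) of
`PolytopeCalculus` charges the pair `(i, j)`, `i < j`, with the CHOSEN unit normal `ν i j`; when a
consumer re-indexes the cells (sub-families = single grains, `Finset.equivFin`), the pair may come out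
as `(j, i)`.  With `ν j i = −ν i j` (this file) and `crossTerm_neg` (`…FacetAreaSymm.lean`) the cross
term `(h_K(ν i j) + h_K(−ν i j)) · facetArea (Q̄_i ∩ Q̄_j) (ν i j)` is then invariant under the swap,
so clause (B)'s double sum is a sum over UNORDERED pairs and survives any re-indexing.

* `exists_disjoint_polytope_refinement_antisymm` — all conclusions of the multi-family refinement,
  plus `ν j i = −ν i j` for all `i, j` (and `ν i i = 0`).
WHAT THIS IS NOT: the facet calculus; nothing on the crux beyond bookkeeping.
-/

noncomputable section

namespace Summit.Ventures.Crystal3D.Theorems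

open MeasureTheory Set
open scoped RealInnerProductSpace Classical

variable {E : Type*} [NormedAddCommGroup E] [InnerProductSpace ℝ E] [FiniteDimensional ℝ E]
  [MeasurableSpace E] [BorelSpace E]

/-- **Disjoint refinement over a common arrangement with antisymmetric normals.** As
`exists_disjoint_polytope_refinement_multi`, with the common-plane normals re-chosen so that
`ν j i = −ν i j` (take the multi-family normal for `i < j` and its negative for `j < i`; the plane
`{⟪−ν, x⟫ = −b}` is the same plane). -/
theorem exists_disjoint_polytope_refinement_antisymm (𝓗 : Finset (E × ℝ)) (h1 : ∀ p ∈ 𝓗, ‖p.1‖ = 1)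
    (𝒢 : Finset (Finset (E × ℝ))) (h𝒢 : ∀ G ∈ 𝒢, G ⊆ 𝓗)
    (hb : ∀ G ∈ 𝒢, Bornology.IsBounded (⋂ p ∈ G, {x : E | ⟪p.1, x⟫ < p.2})) :
    ∃ (k : ℕ) (H : Fin k → Finset (E × ℝ)) (ν : Fin k → Fin k → E),
      (∀ j, Bornology.IsBounded (⋂ q ∈ H j, {x : E | ⟪q.1, x⟫ < q.2})) ∧
      (∀ j, ∀ q ∈ H j, ‖q.1‖ = 1) ∧
      (∀ j, ∀ q ∈ H j, ∀ q' ∈ H j, q ≠ q' →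
        {x : E | ⟪q.1, x⟫ = q.2} ≠ {x : E | ⟪q'.1, x⟫ = q'.2}) ∧
      (∀ j j', j ≠ j' → Disjoint (⋂ q ∈ H j, {x : E | ⟪q.1, x⟫ < q.2})
        (⋂ q ∈ H j', {x : E | ⟪q.1, x⟫ < q.2})) ∧
      (∀ j j', j ≠ j' → ‖ν j j'‖ = 1 ∧ ∃ b : ℝ,
        closure (⋂ q ∈ H j, {x : E | ⟪q.1, x⟫ < q.2}) ∩
          closure (⋂ q ∈ H j', {x : E | ⟪q.1, x⟫ < q.2}) ⊆ {x : E | ⟪ν j j', x⟫ = b}) ∧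
      (∀ j, (⋂ q ∈ H j, {x : E | ⟪q.1, x⟫ < q.2}) ⊆ ⋃ G ∈ 𝒢, ⋂ p ∈ G, {x : E | ⟪p.1, x⟫ < p.2}) ∧
      ((⋃ G ∈ 𝒢, ⋂ p ∈ G, {x : E | ⟪p.1, x⟫ < p.2}) =ᵐ[volume]
        ⋃ j, ⋂ q ∈ H j, {x : E | ⟪q.1, x⟫ < q.2}) ∧
      (∀ j, ∀ G : Finset (E × ℝ), G ⊆ 𝓗 →
        (⋂ q ∈ H j, {x : E | ⟪q.1, x⟫ < q.2}) ⊆ (⋂ p ∈ G, {x : E | ⟪p.1, x⟫ < p.2}) ∨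
        Disjoint (⋂ q ∈ H j, {x : E | ⟪q.1, x⟫ < q.2}) (⋂ p ∈ G, {x : E | ⟪p.1, x⟫ < p.2})) ∧
      (∀ 𝒢' : Finset (Finset (E × ℝ)), 𝒢' ⊆ 𝒢 →
        (⋃ G ∈ 𝒢', ⋂ p ∈ G, {x : E | ⟪p.1, x⟫ < p.2}) =ᵐ[volume]
          ⋃ (j) (_ : ∃ G ∈ 𝒢', (⋂ q ∈ H j, {x : E | ⟪q.1, x⟫ < q.2}) ⊆ ⋂ p ∈ G, {x : E | ⟪p.1, x⟫ < p.2}),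
            ⋂ q ∈ H j, {x : E | ⟪q.1, x⟫ < q.2}) ∧
      (∀ i j, ν j i = -ν i j) := by
  obtain ⟨k, H, ν, hbd, hunit, hdist, hdisj, hplane, hsub, hae, hdich, hfam⟩ :=
    exists_disjoint_polytope_refinement_multi 𝓗 h1 𝒢 h𝒢 hb
  -- antisymmetrised normals
  set ν' : Fin k → Fin k → E := fun i j => if i < j then ν i j else if j < i then -ν j i else 0
    with hν'
  refine ⟨k, H, ν', hbd, hunit, hdist, hdisj, ?_, hsub, hae, hdich, hfam, ?_⟩
  · intro j j' hjj'
    rcases lt_or_gt_of_ne hjj' with hlt | hgt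
    · have hv : ν' j j' = ν j j' := by rw [hν']; simp [hlt]
      rw [hv]
      exact hplane j j' hjj'
    · have hv : ν' j j' = -ν j' j := by
        rw [hν']; simp [hgt, lt_asymm hgt]
      rw [hv]
      obtain ⟨hn, b, hb'⟩ := hplane j' j (ne_of_lt hgt)
      refine ⟨by rw [norm_neg]; exact hn, -b, ?_⟩
      rw [Set.inter_comm]
      intro x hx
      have := hb' hx
      simp only [mem_setOf_eq] at this ⊢
      rw [inner_neg_left, this]
  · intro i j
    rcases lt_trichotomy i j with hlt | heq | hgt
    · rw [hν']; simp [hlt, lt_asymm hlt]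
    · subst heq; rw [hν']; simp
    · rw [hν']; simp [hgt, lt_asymm hgt]

end Summit.Ventures.Crystal3D.Theorems

end
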